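import Mathlib
import Summits.NavierStokesRegularity.NavierStokesRegularity.Theorems.EulerZoomLiouvillePowerGaugeEulerLiouvilleSelfSimilarPressureStrainExcess
import Summits.NavierStokesRegularity.NavierStokesRegularity.Theorems.EulerZoomLiouvillePowerGaugeEulerLiouvilleSelfSimilarPressureParkingAverage
import Summits.NavierStokesRegularity.NavierStokesRegularity.Theorems.EulerZoomLiouvillePowerGaugeEulerLiouvilleSelfSimilarBernoulliSqueezePressureThin
import Literature.Analysis.FluidPDE.SelfSimilarEulerPowerSpreadExclusion
import HarnessLib

/-!
# Pressurised far points of a self-similar MEMBER sit next to strain-dominated points (T2 portrait, member level)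
# (crux `EulerZoomLiouville.PowerGaugeEulerLiouville` = stmt-NavierStokesRegularity-19832; LEAD ns-typeII-p2 g12 RESIDUE-MEMO §2 T2; width seat ns-ezl-w1 g4)

Route №10 `EulerZoomLiouville` (NavierStokesRegularity).  Member-level form of `…SelfSimilarPressureStrainExcess`: for an exactly
self-similar member of Seregin's class with a `C²` profile `V` and any classical pressure `P′` (normalised by the a.e. bridge
`P = P′ + c₀`), the `D`-gauge makes ball AVERAGES of `P′ + c₀` sub-quadratic (`PressureParking.integral_probeBump_pressure_le`), so a
PRESSURISED far point `x₀` (`‖x₀‖ ≤ L`, `P′(x₀) + c₀ ≥ 3κL²`) has a pressure EXCESS `≥ κL²` over the average on the small ball of radius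
`R_L = ((C/κ + 1) L^{−1−2ρ})^{1/3}`; by `exists_strainDominated_near_pressure_excess` some point within `2R_L → 0` of `x₀` is
STRAIN-DOMINATED (`|curl V|² < |∇V|²_F`):

* `exists_strainDominated_near_pressurised_point_member`.

HONEST LABEL: portrait TOOL for T2 (no binder).  WHAT THIS IS NOT: not NS, not E — `--supports` stmt-19832; 19832 OPEN.
[cite: GilbargTrudinger2001, Thm. 2.1; CaffarelliKohnNirenberg1982 §2]
-/

noncomputable section

-- flat `Theorems/<Route><Decl>…` files of one crux share the namespace of the crux (tree convention)
set_option linter.dupNamespace false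

open MeasureTheory Set Filter Topology Metric Function InnerProductSpace TopologicalSpace
open scoped RealInnerProductSpace NNReal ENNReal

namespace Summit.NavierStokesRegularity.NavierStokesRegularity.Theorems.PowerGaugeEulerLiouville.PressureParking

open Literature.Analysis Literature.Analysis.FunctionSpaces Literature.Analysis.FluidPDE

/-- **PRESSURISED FAR POINTS OF A MEMBER HAVE STRAIN-DOMINATED NEIGHBOURS** (T2 portrait, member level).  Crux hypotheses verbatim
(`0 < ρ < 1`), exact self-similarity about the origin with a `C²` profile `V`, a classical pressure `P′`: there are `c₀` (the a.e.
bridge `P = P′ + c₀`), `L₁ ≥ 1` and `C ≥ 0` such that for `L ≥ L₁`, every `x₀` with `‖x₀‖ ≤ L` and `P′(x₀) + c₀ ≥ 3κL²` has a point `z`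
with `dist z x₀ < 2((C/κ + 1)L^{−1−2ρ})^{1/3}` and `|curl V(z)|² < |∇V(z)|²_F`. [cite: GilbargTrudinger2001, Thm. 2.1] -/
theorem exists_strainDominated_near_pressurised_point_member {ρ : ℝ} (hρ : 0 < ρ) (hρ1 : ρ < 1)
    {u : ℝ → EuclideanSpace ℝ (Fin 3) → EuclideanSpace ℝ (Fin 3)} {p : ℝ → EuclideanSpace ℝ (Fin 3) → ℝ}
    {H : ℝ → EuclideanSpace ℝ (Fin 3) → EuclideanSpace ℝ (Fin 3) →L[ℝ] EuclideanSpace ℝ (Fin 3)} {c : ℝ≥0}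
    (hsw : IsSuitableWeakSolutionOn (slab (EuclideanSpace ℝ (Fin 3)) (Iio 0) isOpen_Iio) 0 0 u p)
    (hgauge : ∀ a : ℝ, 0 < a →
      ENNReal.ofReal (a ^ (2 * ρ)) * cknA a (0 : ℝ × EuclideanSpace ℝ (Fin 3)) u +
          ENNReal.ofReal (a ^ ρ) * cknE a (0 : ℝ × EuclideanSpace ℝ (Fin 3)) H +
        ENNReal.ofReal (a ^ (2 * ρ)) * cknD a (0 : ℝ × EuclideanSpace ℝ (Fin 3)) p ≤ (c : ℝ≥0∞))
    {V : EuclideanSpace ℝ (Fin 3) → EuclideanSpace ℝ (Fin 3)} {P : EuclideanSpace ℝ (Fin 3) → ℝ}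
    (hu : ∀ τ : ℝ, τ < 0 → u τ = selfSimilarCollapse (1 / (2 + ρ)) 0 V τ)
    (hp : ∀ τ : ℝ, τ < 0 → p τ = selfSimilarCollapsePressure (1 / (2 + ρ)) 0 P τ)
    (hV : ContDiff ℝ 2 V) {P' : EuclideanSpace ℝ (Fin 3) → ℝ}
    (hprof : IsSelfSimilarEulerProfile (1 / (2 + ρ)) 0 V P') {κ : ℝ} (hκ : 0 < κ) :
    ∃ c₀ L₁ C : ℝ, 1 ≤ L₁ ∧ 0 ≤ C ∧ (P =ᵐ[volume] fun y => P' y + c₀) ∧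
      ∀ L : ℝ, L₁ ≤ L → ∀ x₀ : EuclideanSpace ℝ (Fin 3), ‖x₀‖ ≤ L → 3 * κ * L ^ 2 ≤ P' x₀ + c₀ →
        ∃ z : EuclideanSpace ℝ (Fin 3), dist z x₀ < 2 * ((C / κ + 1) * L ^ (-1 - 2 * ρ)) ^ (1 / 3 : ℝ) ∧
          ‖curl V z‖ ^ 2 < frobeniusNormSq (fderiv ℝ V z) := by
  have h2ρ : (0 : ℝ) < 2 + ρ := by linarith
  -- the class pressure profile and its weighted `D`-datum (as in `…ParkingMember`)
  have hD : ∀ a : ℝ, 0 < a → ENNReal.ofReal (a ^ (2 * ρ)) *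
      cknD a (0 : ℝ × EuclideanSpace ℝ (Fin 3)) p ≤ (c : ℝ≥0∞) :=
    fun a ha => le_trans le_add_self (hgauge a ha)
  have hpm : AEStronglyMeasurable (uncurry p)
      (volume.restrict (Iio (0 : ℝ) ×ˢ (univ : Set (EuclideanSpace ℝ (Fin 3))))) := by
    have := hsw.distributional.2.2.1.aestronglyMeasurable
    simpa [slab] using this
  have hPm := aestronglyMeasurable_pressureProfile hpm hp
  have hDprof := profile_pressure_weight_of_gaugeD hρ hρ1 hpm hp hD
  have hP1 : LocallyIntegrable P volume :=
    EnergySaturation.locallyIntegrable_pressure_of_weight hρ1 hPm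
      (ENNReal.mul_ne_top ENNReal.ofReal_ne_top ENNReal.coe_ne_top) hDprof
  obtain ⟨c₀, hc₀⟩ := WeakToClassical.pressureProfile_ae_eq_add_const hsw.distributional hu hp hV hP1 hprof
  have hprof'' : IsSelfSimilarEulerProfile (1 / (2 + ρ)) 0 V (fun y => P' y + c₀) := hprof.add_const
  have hCD : (0 : ℝ) ≤ (2 - 2 * ρ) / (2 + ρ) * c := by
    have : (0 : ℝ) ≤ (2 - 2 * ρ) / (2 + ρ) := div_nonneg (by linarith) h2ρ.le
    exact mul_nonneg this (NNReal.coe_nonneg c)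
  have hD'' : ∫⁻ y, ‖P' y + c₀‖ₑ ^ (3 / 2 : ℝ) * ENNReal.ofReal (‖y‖ ^ (2 * ρ - 2)) ≤
      ENNReal.ofReal ((2 - 2 * ρ) / (2 + ρ) * c) := by
    have e : (fun y : EuclideanSpace ℝ (Fin 3) => ‖P' y + c₀‖ₑ ^ (3 / 2 : ℝ) * ENNReal.ofReal (‖y‖ ^ (2 * ρ - 2))) =ᵐ[volume]
        fun y => ‖P y‖ₑ ^ (3 / 2 : ℝ) * ENNReal.ofReal (‖y‖ ^ (2 * ρ - 2)) := by
      filter_upwards [hc₀] with y hy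
      rw [hy]
    rw [lintegral_congr_ae e]
    refine hDprof.trans (le_of_eq ?_)
    rw [ENNReal.ofReal_mul (by apply div_nonneg <;> linarith), ENNReal.ofReal_coe_nnreal]
  -- sub-quadratic ball averages
  obtain ⟨C, L₁, hC, hL₁, havg⟩ := integral_probeBump_pressure_le hprof'' hρ1 hCD hD'' hκ
  -- the scale threshold: `(C/κ + 1) L^{−1−2ρ} ≤ L³` once `L ≥ L₂`
  obtain ⟨L₂, hL₂1, hL₂⟩ : ∃ L₂ : ℝ, 1 ≤ L₂ ∧ ∀ L : ℝ, L₂ ≤ L → (C / κ + 1) * L ^ (-1 - 2 * ρ) ≤ L ^ 3 := by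
    refine ⟨max 1 (C / κ + 1), le_max_left _ _, fun L hL => ?_⟩
    have hL1 : 1 ≤ L := (le_max_left _ _).trans hL
    have hL0 : 0 < L := by linarith
    have h1 : L ^ (-1 - 2 * ρ) ≤ 1 := Real.rpow_le_one_of_one_le_of_nonpos hL1 (by linarith)
    have h2 : C / κ + 1 ≤ L := (le_max_right _ _).trans hL
    have h3 : L ≤ L ^ 3 := by
      calc L = L * 1 * 1 := by ring
        _ ≤ L * L * L := by gcongr
        _ = L ^ 3 := by ring
    have h4 : 0 ≤ C / κ + 1 := by positivity
    calc (C / κ + 1) * L ^ (-1 - 2 * ρ) ≤ (C / κ + 1) * 1 := mul_le_mul_of_nonneg_left h1 h4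
      _ ≤ L ^ 3 := by linarith
  refine ⟨c₀, max L₁ L₂, C, le_max_of_le_left hL₁, hC, hc₀, fun L hL x₀ hx₀ hPx => ?_⟩
  have hLL₁ : L₁ ≤ L := (le_max_left _ _).trans hL
  have hLL₂ : L₂ ≤ L := (le_max_right _ _).trans hL
  have hL1 : 1 ≤ L := hL₁.trans hLL₁
  have hL0 : 0 < L := by linarith
  -- the small radius `R = ((C/κ + 1) L^{−1−2ρ})^{1/3}`
  set A : ℝ := (C / κ + 1) * L ^ (-1 - 2 * ρ) with hA
  have hA0 : 0 < A := by rw [hA]; exact mul_pos (by positivity) (Real.rpow_pos_of_pos hL0 _)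
  set R : ℝ := A ^ (1 / 3 : ℝ) with hRdef
  have hR0 : 0 < R := Real.rpow_pos_of_pos hA0 _
  have hR3 : R ^ 3 = A := by
    rw [hRdef, ← Real.rpow_natCast, ← Real.rpow_mul hA0.le]; norm_num
  have hRL : R ≤ L := by
    have h := hL₂ L hLL₂
    rw [← hA, ← hR3] at h
    exact le_of_pow_le_pow_left₀ three_ne_zero hL0.le h
  -- the excess: average ≤ 2κL²
  have havg' := havg L hLL₁ x₀ hx₀ R hR0 hRL
  have hCterm : C * L ^ (1 - 2 * ρ) / R ^ 3 ≤ κ * L ^ 2 := by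
    rw [hR3, hA, div_le_iff₀ hA0]
    have e : L ^ (1 - 2 * ρ) = L ^ 2 * L ^ (-1 - 2 * ρ) := by
      rw [← Real.rpow_natCast, ← Real.rpow_add hL0]
      congr 1
      push_cast
      ring
    rw [e]
    have hLpow : 0 < L ^ (-1 - 2 * ρ) := Real.rpow_pos_of_pos hL0 _
    have : C * (L ^ 2 * L ^ (-1 - 2 * ρ)) = (C / κ) * (κ * L ^ 2) * L ^ (-1 - 2 * ρ) := by
      field_simp
    rw [this]
    nlinarith [mul_pos (mul_pos hκ (pow_pos hL0 2)) hLpow, div_nonneg hC hκ.le]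
  have hex : κ * L ^ 2 + (∫ y, probeBump R y * (fun y => P' y + c₀) (x₀ + y)) ≤ (fun y => P' y + c₀) x₀ := by
    simp only
    linarith
  have hκL : 0 < κ * L ^ 2 := by positivity
  obtain ⟨z, hz, hzs⟩ := exists_strainDominated_near_pressure_excess hprof'' hR0 x₀ hκL hex
  exact ⟨z, by rw [mem_ball] at hz; rw [hRdef, hA] at hz; exact hz, hzs⟩

end Summit.NavierStokesRegularity.NavierStokesRegularity.Theorems.PowerGaugeEulerLiouville.PressureParking

end
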